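import Mathlib
import Literature.Barriers.KontsevichZagierPeriods.AlgebraicPrimitivesObstruction
import Literature.ModelTheory.ExponentialFields.SemialgebraicC1TriangulationProofs
import Summits.KontsevichZagierPeriods.KontsevichZagierPeriods.Theorems.StuffleInKZ.Negative.GrowthTranscendence

/-!
# `GpcZeta4Eq4zeta31` (stmt-KontsevichZagierPeriods-0275): negative side — one-variable toolkit
# "algebraic on an interval" for the STOKES SHADOW of a move chain

Support file (cdisprove unit, cycle 2, refuter `refuter-cdisprove-stmt-KontsevichZagierPeriods-0275-g2-0`,
2026-08-16) for `StokesShadow.lean`: the first obstruction on this crux compatible with ALL Newton–Leibniz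
moves. The mechanism: the only part of a move chain that a first-coordinate marginal does not see are the
Newton–Leibniz moves from dimension `1` to dimension `0`, and what THEY leave behind is a finite sum of
`ℚ`-semialgebraic primitives of one variable — functions ALGEBRAIC over `ℝ(x)` on an interval. This file
is the pure one-variable algebra/calculus of that notion:

* `AlgOn I f` — some non-zero `P ∈ ℝ[X][Y]` has `P(s, f s) = 0` for all `s ∈ I`; `algOn_iff_isAlgebraic`
  identifies it with Mathlib's `IsAlgebraic ℝ[X]` in the function algebra `I → ℝ`, whence closure under
  `+ − *`, inverses of non-vanishing functions, polynomial expressions (`AlgOn.add/sub/mul/inv/evalEval`);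
* `algOn_of_isSemialgebraicFunOn` — a `ℚ`-semialgebraic function of one real variable is algebraic
  (steps (A)+(B) of the catalogued barrier `Literature/Barriers/KontsevichZagierPeriods/
  AlgebraicPrimitivesObstruction.lean`, no Tarski–Seidenberg);
* (companion `AlgebraicDerivative.lean`) `AlgOn.exists_algOn_deriv` — the derivative of an algebraic
  differentiable function is algebraic on a sub-interval; `not_algOn_of_hasDerivAt_one_div_one_sub` — no
  function with derivative `1/(1 − t)` is algebraic on any interval below `1`.

Sources: J. Bochnak, M. Coste, M.-F. Roy, *Real Algebraic Geometry* (1998), §2; J. Ayoub, *Une version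
relative de la conjecture des périodes de Kontsevich–Zagier*, Ann. of Math. 181 (2015), Rem. 1.2 (a
primitive of an algebraic function is in general transcendental); [folklore] throughout.
-/

noncomputable section

namespace Summit.KontsevichZagierPeriods.GpcZeta4Eq4zeta31.Negative

open Set Polynomial
open scoped Polynomial.Bivariate
open Literature.Barriers.KontsevichZagierPeriods.KZ (NoSemialgPrim.exists_ne_zero_isOpen
  NoSemialgPrim.evalEval_equivMvPolynomial_symm)

/-! ## §1 Algebraic functions on a set of reals -/

/-- `f` is ALGEBRAIC over `ℝ(x)` on `I ⊆ ℝ`: a non-zero bivariate real polynomial vanishes on the graph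
of `f` over `I`. -/
def AlgOn (I : Set ℝ) (f : ℝ → ℝ) : Prop :=
  ∃ P : ℝ[X][Y], P ≠ 0 ∧ ∀ s ∈ I, P.evalEval s (f s) = 0

namespace AlgOn

variable {I J : Set ℝ} {f g : ℝ → ℝ}

/-- Restriction to a subset. [folklore] -/
theorem mono (h : AlgOn I f) (hJ : J ⊆ I) : AlgOn J f := by
  obtain ⟨P, hP, hv⟩ := h
  exact ⟨P, hP, fun s hs => hv s (hJ hs)⟩

/-- Only the values on `I` matter. [folklore] -/
theorem congr (h : AlgOn I f) (hfg : EqOn f g I) : AlgOn I g := by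
  obtain ⟨P, hP, hv⟩ := h
  exact ⟨P, hP, fun s hs => by rw [← hfg hs]; exact hv s hs⟩

end AlgOn

/-- Polynomial functions are algebraic (`P = Y − p(X)`). [folklore] -/
theorem algOn_eval (I : Set ℝ) (p : ℝ[X]) : AlgOn I fun s => p.eval s := by
  refine ⟨X - C p, ?_, fun s _ => by simp [evalEval]⟩
  intro h
  have := congrArg natDegree h
  rw [natDegree_X_sub_C, natDegree_zero] at this
  exact one_ne_zero this

/-- Constants are algebraic. [folklore] -/
theorem algOn_const (I : Set ℝ) (c : ℝ) : AlgOn I fun _ => c := by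
  simpa using algOn_eval I (C c)

/-- The coordinate function is algebraic. [folklore] -/
theorem algOn_id (I : Set ℝ) : AlgOn I fun s => s := by
  simpa using algOn_eval I X

/-! ## §2 The function algebra `I → ℝ` over `ℝ[X]` and the bridge to `IsAlgebraic` -/

section FunctionAlgebra

variable (I : Set ℝ)

/-- `I → ℝ` as an `ℝ[X]`-algebra through the coordinate function `s ↦ s`. -/
@[reducible] def fnAlgebra : Algebra ℝ[X] (↥I → ℝ) :=
  (Polynomial.aeval (fun s : ↥I => (s : ℝ))).toRingHom.toAlgebra

attribute [local instance] fnAlgebra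

/-- The structure map is evaluation of the polynomial at the point. [folklore] -/
theorem algebraMap_fn_apply (p : ℝ[X]) (s : ↥I) : algebraMap ℝ[X] (↥I → ℝ) p s = p.eval (s : ℝ) := by
  change (Polynomial.aeval (fun s : ↥I => (s : ℝ)) p) s = p.eval (s : ℝ)
  rw [Polynomial.aeval_fn_apply, Polynomial.coe_aeval_eq_eval]

variable {I}

/-- **Bridge**: `aeval` in the function algebra is pointwise bivariate evaluation. [folklore] -/
theorem aeval_fn_eq (F : ↥I → ℝ) (P : ℝ[X][Y]) (s : ↥I) :
    (aeval F P) s = P.evalEval (s : ℝ) (F s) := by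
  -- both sides are ring homomorphisms in `P`; compare on `C p` and on `Y`
  have key : ((Pi.evalRingHom (fun _ : ↥I => ℝ) s).comp (aeval F).toRingHom) =
      evalEvalRingHom (s : ℝ) (F s) := by
    refine Polynomial.ringHom_ext (fun p => ?_) ?_
    · change (aeval F (C p)) s = (C p : ℝ[X][Y]).evalEval (s : ℝ) (F s)
      rw [aeval_C, algebraMap_fn_apply, evalEval_C]
    · change (aeval F (X : ℝ[X][Y])) s = (X : ℝ[X][Y]).evalEval (s : ℝ) (F s)
      rw [aeval_X, evalEval_X]
  exact congrArg (fun φ : ℝ[X][Y] →+* ℝ => φ P) key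

/-- **`AlgOn` is Mathlib's `IsAlgebraic ℝ[X]` in the function algebra.** [folklore] -/
theorem algOn_iff_isAlgebraic (f : ℝ → ℝ) :
    AlgOn I f ↔ IsAlgebraic ℝ[X] (fun s : ↥I => f s) := by
  constructor
  · rintro ⟨P, hP, hv⟩
    refine ⟨P, hP, funext fun s => ?_⟩
    rw [aeval_fn_eq]
    exact hv s s.2
  · rintro ⟨P, hP, hv⟩
    refine ⟨P, hP, fun s hs => ?_⟩
    have := congrFun hv ⟨s, hs⟩
    rwa [aeval_fn_eq] at this

namespace AlgOn

variable {f g : ℝ → ℝ}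

/-- Sums of algebraic functions are algebraic. [folklore] -/
theorem add (hf : AlgOn I f) (hg : AlgOn I g) : AlgOn I (f + g) := by
  rw [algOn_iff_isAlgebraic] at hf hg ⊢
  exact hf.add hg

/-- Negatives of algebraic functions are algebraic. [folklore] -/
theorem neg (hf : AlgOn I f) : AlgOn I (-f) := by
  rw [algOn_iff_isAlgebraic] at hf ⊢
  exact hf.neg

/-- Differences of algebraic functions are algebraic. [folklore] -/
theorem sub (hf : AlgOn I f) (hg : AlgOn I g) : AlgOn I (f - g) := by
  rw [algOn_iff_isAlgebraic] at hf hg ⊢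
  exact hf.sub hg

/-- Products of algebraic functions are algebraic. [folklore] -/
theorem mul (hf : AlgOn I f) (hg : AlgOn I g) : AlgOn I (f * g) := by
  rw [algOn_iff_isAlgebraic] at hf hg ⊢
  exact hf.mul hg

/-- Polynomial expressions `Q(s, F s)` in an algebraic function are algebraic. [folklore] -/
theorem evalEval (hF : AlgOn I f) (Q : ℝ[X][Y]) : AlgOn I fun s => Q.evalEval s (f s) := by
  rw [algOn_iff_isAlgebraic] at hF ⊢
  set F : ↥I → ℝ := fun s => f s
  have hmem : aeval F Q ∈ Subalgebra.algebraicClosure ℝ[X] (↥I → ℝ) := by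
    have hF' : F ∈ Subalgebra.algebraicClosure ℝ[X] (↥I → ℝ) :=
      (Subalgebra.mem_algebraicClosure ℝ[X] (↥I → ℝ)).2 hF
    exact Algebra.adjoin_le (Set.singleton_subset_iff.2 hF') (Polynomial.aeval_mem_adjoin_singleton _ _)
  have h := (Subalgebra.mem_algebraicClosure ℝ[X] (↥I → ℝ)).1 hmem
  have e : (aeval F Q) = fun s : ↥I => Q.evalEval (s : ℝ) (f s) := funext fun s => aeval_fn_eq F Q s
  rwa [e] at h

/-- Inverses of non-vanishing algebraic functions are algebraic. [folklore] -/
theorem inv (hf : AlgOn I f) (h0 : ∀ s ∈ I, f s ≠ 0) : AlgOn I fun s => (f s)⁻¹ := by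
  rw [algOn_iff_isAlgebraic] at hf ⊢
  set F : ↥I → ℝ := fun s => f s
  letI : Invertible F :=
    ⟨fun s => (f s)⁻¹, funext fun s => inv_mul_cancel₀ (h0 s s.2), funext fun s => mul_inv_cancel₀ (h0 s s.2)⟩
  exact hf.invOf

/-- Quotients by non-vanishing algebraic functions are algebraic. [folklore] -/
theorem div (hf : AlgOn I f) (hg : AlgOn I g) (h0 : ∀ s ∈ I, g s ≠ 0) : AlgOn I fun s => f s / g s := by
  refine (hf.mul (hg.inv h0)).congr fun s _ => ?_
  simp [div_eq_mul_inv]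

end AlgOn

end FunctionAlgebra

/-! ## §3 Semialgebraic functions of one variable are algebraic (barrier steps (A)+(B)) -/

/-- **A `ℚ`-semialgebraic function of one real variable is algebraic over `ℝ(x)`** on its domain
`{x | x 0 ∈ T}`: its graph has empty interior in `ℝ²`, so it lies in the zero set of the non-zero
polynomial off which the graph is open (`NoSemialgPrim.exists_ne_zero_isOpen`, induction over the Boolean
algebra of semialgebraic sets — no Tarski–Seidenberg). [folklore] -/
theorem algOn_of_isSemialgebraicFunOn {T : Set ℝ} {F : (Fin 1 → ℝ) → ℝ}
    (hF : Literature.NumberTheory.Transcendental.IsSemialgebraicFunOn ℚ {x : Fin 1 → ℝ | x 0 ∈ T} F) :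
    AlgOn T fun t => F fun _ => t := by
  set Γ : Set (Fin 2 → ℝ) :=
    {z | ∃ x ∈ {x : Fin 1 → ℝ | x 0 ∈ T}, z = Fin.snoc x (F x)} with hΓ
  have hΓ' : Literature.ModelTheory.ExponentialFields.IsSemialgebraic ℚ Γ := hF
  obtain ⟨q, hq0, hopen, -⟩ := NoSemialgPrim.exists_ne_zero_isOpen hΓ'
  have hvan : ∀ z ∈ Γ, MvPolynomial.eval z q = 0 := by
    intro z hz
    by_contra hne
    obtain ⟨ε, hε, hball⟩ := Metric.isOpen_iff.mp hopen z ⟨hz, hne⟩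
    obtain ⟨x, hx, rfl⟩ := hz
    have hmem : (Fin.snoc x (F x + ε / 2) : Fin 2 → ℝ) ∈
        Metric.ball (Fin.snoc x (F x) : Fin 2 → ℝ) ε := by
      rw [Metric.mem_ball, dist_pi_lt_iff hε]
      intro i
      fin_cases i
      · simp [Fin.snoc, hε]
      · simp [Fin.snoc, abs_of_pos hε, half_lt_self hε]
    obtain ⟨⟨x', -, hxx'⟩, -⟩ := hball hmem
    have h0 : x = x' := by
      funext j
      fin_cases j
      simpa [Fin.snoc] using congrFun hxx' 0
    have h1 := congrFun hxx' 1
    simp only [Fin.snoc] at h1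
    simp [← h0] at h1
    exact absurd h1 hε.ne'
  refine ⟨(Polynomial.Bivariate.equivMvPolynomial ℝ).symm q, by simpa using hq0, ?_⟩
  intro t ht
  have hz : (Fin.snoc (fun _ : Fin 1 => t) (F fun _ => t) : Fin 2 → ℝ) ∈ Γ :=
    ⟨fun _ => t, ht, rfl⟩
  have h := hvan _ hz
  rw [← NoSemialgPrim.evalEval_equivMvPolynomial_symm] at h
  simpa [Fin.snoc] using h

/-! ## §4 Explicit coefficient sums and their evaluation

(`P.evalEval s y = Σⱼ (P.coeff j).eval s · yʲ` is the sibling seat's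
`StuffleInKZ.Negative.Growth.evalEval_eq_sum_range`; joint continuity of bivariate evaluation is the
Literature theorem `Literature.ModelTheory.ExponentialFields.continuous_evalEval` — both imported, not copied.) -/

/-- Evaluation of an explicit sum `∑_{j<N} C (q j) Y^j`. [folklore] -/
theorem evalEval_sum_C_mul_X_pow (q : ℕ → ℝ[X]) (N : ℕ) (x y : ℝ) :
    (∑ j ∈ Finset.range N, C (q j) * (X : ℝ[X][Y]) ^ j).evalEval x y =
      ∑ j ∈ Finset.range N, (q j).eval x * y ^ j := by
  rw [← coe_evalEvalRingHom, map_sum]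
  refine Finset.sum_congr rfl fun j _ => ?_
  rw [map_mul, map_pow, coe_evalEvalRingHom, evalEval_C, evalEval_X]

end Summit.KontsevichZagierPeriods.GpcZeta4Eq4zeta31.Negative
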